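import Mathlib
import Summits.ValiantsHypothesis.ValiantsHypothesis.Theorems.RigidityForcesSymmetryRankRigidMinimalReprLaplaceResidualCaseTwoKernel
import Summits.ValiantsHypothesis.ValiantsHypothesis.Theorems.RigidityForcesSymmetryRankRigidMinimalReprLaplaceResidualReduction
import Summits.ValiantsHypothesis.ValiantsHypothesis.Theorems.RigidityForcesSymmetryRankRigidMinimalReprLaplaceResidualTools
import Summits.ValiantsHypothesis.ValiantsHypothesis.Theorems.RigidityForcesSymmetryRankRigidMinimalReprLaplaceFiveCoreCertified

/-!
# `LaplaceOptimalFive`, the residual configuration `(0; 02, 12, 34)`: CASE 2 (slice vector at slot `0` a letter indicator)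
# (crux `RankRigidMinimalRepr`, stmt-ValiantsHypothesis-18034; frontier rung `LaplaceOptimalFive`, stmt-24813)

The fourth residual sorted labelled configuration of `laplace_five_three_slices_residual` — slices on slots `0,1,2`, pair cuts
`{0,2}, {1,2}, {3,4}` (slot `0` a leaf attached to the hub `2`) — under the CASE-2 hypothesis «the slice vector `α 0` is a
letter indicator».  Same dual witness as `outside_leaf_case2` (`…LaplaceResidualCase2.lean`, this seat) with the ROLES of the
slots `1` and `2` exchanged: `φ₀ := 𝟙 − e_a` at slot `0`; the kernel-line covector `ψ` of `caseTwo_exists_phi1` (p617182) sits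
at slot `2` (⊥ `α 2`, killing the cut `{0,2}` charged at slot `2` against `φ₀`); the covector `χ` of val-port-2's REDUCTION
`exists_orthogonal_not_proportional` sits at slot `1` (⊥ `α 1`, killing `{1,2}` charged at slot `1` against `ψ`, two-slot form
`F(φ₀,ψ,χ) ∉ ℂ·N`, `N` the fixed form `u₂` of the outside cut); `φ₃, φ₄` by LEMMA C; `refute_of_kills`.  The exchange is
legitimate because the fibre sum is SYMMETRIC in its two inner covectors (`fibreSum_swap12`: `σ ↦ σ·(1 2)`).

* `fibreSum_swap12`, `outside_leaf_case2'`.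
Seat val-lit-p3 g14 (second hand under val-port-2's cut; val-lit desk RULINGS #260 (c) / #263 (c)).  No definitions.

HONEST FRAMING: an exact partial result toward the frontier rung `LaplaceOptimalFive` (stmt-24813), which stays OPEN (CASE 1 of
this configuration with the hub covector at slot `0`, and the assembly of `hres`, remain with the other hands); nothing here
bears on `VP ≠ VNP`, which is NOT proved.
-/

set_option autoImplicit false

-- the mandated summit-side namespace repeats a component by design (single-problem summit)
set_option linter.dupNamespace false

namespace Summit.ValiantsHypothesis.ValiantsHypothesis.Theorems.RigidityForcesSymmetryRankRigidMinimalRepr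

namespace LaplaceResidual

open Finset

/-- **The fibre sum is symmetric in its two inner covectors**: `F(φ₀, u, v)(x,y) = F(φ₀, v, u)(x,y)`
(reindex `σ ↦ σ · (1 2)`). [folklore] -/
theorem fibreSum_swap12 (φ₀ u v : Fin 5 → ℂ) (x y : Fin 5) :
    (∑ σ : Equiv.Perm (Fin 5), if σ 3 = x ∧ σ 4 = y then φ₀ (σ 0) * u (σ 1) * v (σ 2) else 0) =
      ∑ σ : Equiv.Perm (Fin 5), if σ 3 = x ∧ σ 4 = y then φ₀ (σ 0) * v (σ 1) * u (σ 2) else 0 := by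
  refine Fintype.sum_equiv (Equiv.mulRight (Equiv.swap (1 : Fin 5) 2)) _ _ (fun σ => ?_)
  have h0 : (σ * Equiv.swap (1 : Fin 5) 2) 0 = σ 0 := by
    rw [Equiv.Perm.mul_apply, Equiv.swap_apply_of_ne_of_ne (by decide) (by decide)]
  have h1 : (σ * Equiv.swap (1 : Fin 5) 2) 1 = σ 2 := by
    rw [Equiv.Perm.mul_apply, Equiv.swap_apply_left]
  have h2 : (σ * Equiv.swap (1 : Fin 5) 2) 2 = σ 1 := by
    rw [Equiv.Perm.mul_apply, Equiv.swap_apply_right]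
  have h3 : (σ * Equiv.swap (1 : Fin 5) 2) 3 = σ 3 := by
    rw [Equiv.Perm.mul_apply, Equiv.swap_apply_of_ne_of_ne (by decide) (by decide)]
  have h4 : (σ * Equiv.swap (1 : Fin 5) 2) 4 = σ 4 := by
    rw [Equiv.Perm.mul_apply, Equiv.swap_apply_of_ne_of_ne (by decide) (by decide)]
  simp only [Equiv.coe_mulRight, h0, h1, h2, h3, h4]
  split_ifs <;> ring

/-- **The configuration `(0; 02, 12, 34)`, CASE 2.**  Slices `α_k(v_k) W_k(v)` on slots `0,1,2` and pair terms on the cuts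
`{0,2}, {1,2}, {3,4}` never sum to the `5 × 5` permutation pattern, provided the slice vector at slot `0` is a letter indicator.
[folklore] -/
theorem outside_leaf_case2' (α : Fin 3 → Fin 5 → ℂ) (W : Fin 3 → (Fin 5 → Fin 5) → ℂ)
    (hW : ∀ k, ∀ v v' : Fin 5 → Fin 5, (∀ j, j ≠ (![0, 1, 2] : Fin 3 → Fin 5) k → v j = v' j) → W k v = W k v')
    (u w : Fin 3 → (Fin 5 → Fin 5) → ℂ)
    (hu : ∀ t, ∀ v v' : Fin 5 → Fin 5, v ((![0, 1, 3] : Fin 3 → Fin 5) t) = v' ((![0, 1, 3] : Fin 3 → Fin 5) t) →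
      v ((![2, 2, 4] : Fin 3 → Fin 5) t) = v' ((![2, 2, 4] : Fin 3 → Fin 5) t) → u t v = u t v')
    (hw : ∀ t, ∀ v v' : Fin 5 → Fin 5, (∀ j, j ≠ (![0, 1, 3] : Fin 3 → Fin 5) t →
      j ≠ (![2, 2, 4] : Fin 3 → Fin 5) t → v j = v' j) → w t v = w t v')
    (hind : ∃ a : Fin 5, α 0 a ≠ 0 ∧ ∀ c, c ≠ a → α 0 c = 0) :
    ¬ ∀ v : Fin 5 → Fin 5, (if Function.Injective v then (1 : ℂ) else 0) =
      (∑ k, α k (v ((![0, 1, 2] : Fin 3 → Fin 5) k)) * W k v) + ∑ t, u t v * w t v := by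
  classical
  obtain ⟨a, -, hαoff⟩ := hind
  let φ₀ : Fin 5 → ℂ := fun x => if x = a then (0 : ℂ) else 1
  have hφ₀α : ∑ c, φ₀ c * α 0 c = 0 := indicator_orthogonal a (α 0) hαoff
  let c0 : Fin 5 := 0
  -- cut {0,2}, charged at slot 2 against `φ₀`
  let μ₂ : Fin 5 → ℂ := fun y => ∑ a, φ₀ a * u 0 (Function.update (Function.update (fun _ => c0) 0 a) 2 y)
  -- the fixed form of the outside cut {3,4}
  let N : Fin 5 → Fin 5 → ℂ := fun y z => u 2 (Function.update (Function.update (fun _ => c0) 3 y) 4 z)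
  -- `ψ` at slot 2: in `{⊥ α 2, ⊥ μ₂}` with the kernel-line property
  obtain ⟨ψ, wv, hψγ, hψμ, hline⟩ := caseTwo_exists_phi1 a (α 2) μ₂
  -- cut {1,2}, charged at slot 1 against `ψ`
  let μ₁ : Fin 5 → ℂ := fun y => ∑ a, ψ a * u 1 (Function.update (Function.update (fun _ => c0) 2 a) 1 y)
  -- `χ` at slot 1: ⊥ α 1, ⊥ μ₁, two-slot form `F(φ₀,ψ,χ) ∉ ℂ·N`
  obtain ⟨χ, hχβ, hχμ, hnot⟩ := exists_orthogonal_not_proportional φ₀ ψ wv hline (α 1) μ₁ N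
  let M : Fin 5 → Fin 5 → ℂ := fun x y =>
    ∑ σ : Equiv.Perm (Fin 5), if σ 3 = x ∧ σ 4 = y then φ₀ (σ 0) * ψ (σ 1) * χ (σ 2) else 0
  obtain ⟨φ₃, φ₄, hN0, hM0⟩ : ∃ φ₃ φ₄ : Fin 5 → ℂ, (∑ i, ∑ j, φ₃ i * N i j * φ₄ j) = 0 ∧
      (∑ i, ∑ j, φ₃ i * M i j * φ₄ j) ≠ 0 := by
    by_contra h
    push Not at h
    exact hnot (bilinear_proportional M N h)
  -- the witness: `χ` at slot 1, `ψ` at slot 2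
  let φ : Fin 5 → Fin 5 → ℂ := ![φ₀, χ, ψ, φ₃, φ₄]
  have hφ0 : φ 0 = φ₀ := rfl
  have hφ1 : φ 1 = χ := rfl
  have hφ2 : φ 2 = ψ := rfl
  have hφ3 : φ 3 = φ₃ := rfl
  have hφ4 : φ 4 = φ₄ := rfl
  have hMsym : ∀ x y : Fin 5,
      (∑ σ : Equiv.Perm (Fin 5), if σ 3 = x ∧ σ 4 = y then φ₀ (σ 0) * χ (σ 1) * ψ (σ 2) else 0) = M x y :=
    fun x y => fibreSum_swap12 φ₀ χ ψ x y
  have hper : (Matrix.of fun c s => φ s c).permanent ≠ 0 := by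
    rw [permanent_two_slot φ, hφ0, hφ1, hφ2, hφ3, hφ4]
    simp only [hMsym]
    exact hM0
  refine LaplaceFiveSlices.refute_of_kills ![0, 1, 2] α W hW ![0, 1, 3] ![2, 2, 4] (by decide) u w hu hw
    ![false, false, false] ![2, 1, 4] ![0, 2, 3] ![0, 0, 0] ![0, 0, 0] ?_ ?_ φ hper ?_ ?_ ?_
  · intro t ht; fin_cases t
    · right; exact ⟨rfl, rfl⟩
    · left; exact ⟨rfl, rfl⟩
    · right; exact ⟨rfl, rfl⟩
  · intro t ht; fin_cases t
    · exact absurd ht (by decide)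
    · exact absurd ht (by decide)
    · exact absurd ht (by decide)
  · intro k; fin_cases k
    · exact hφ₀α
    · exact hχβ
    · exact hψγ
  · intro t ht; fin_cases t
    · -- cut {0,2}, charged at slot 2 against slot 0
      show ∑ y, φ 2 y * ∑ a, φ 0 a * u 0 (Function.update (Function.update (fun _ => (0 : Fin 5)) 0 a) 2 y) = 0
      rw [hφ0, hφ2]; exact hψμ
    · -- cut {1,2}, charged at slot 1 against slot 2
      show ∑ y, φ 1 y * ∑ a, φ 2 a * u 1 (Function.update (Function.update (fun _ => (0 : Fin 5)) 2 a) 1 y) = 0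
      rw [hφ1, hφ2]; exact hχμ
    · show ∑ y, φ 4 y * ∑ a, φ 3 a * u 2 (Function.update (Function.update (fun _ => (0 : Fin 5)) 3 a) 4 y) = 0
      rw [hφ3, hφ4, ← hN0]
      simp only [N, Fin.sum_univ_five]
      ring
  · intro t ht; fin_cases t
    · exact absurd ht (by decide)
    · exact absurd ht (by decide)
    · exact absurd ht (by decide)

end LaplaceResidual

end Summit.ValiantsHypothesis.ValiantsHypothesis.Theorems.RigidityForcesSymmetryRankRigidMinimalRepr
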